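import Summits.RiemannHypothesis.RiemannHypothesis.Theses.WeilComb
import Summits.RiemannHypothesis.RiemannHypothesis.Theorems.WeilCombCombShapeDetection
import Summits.RiemannHypothesis.RiemannHypothesis.Theorems.WeilCombCombShapeAdmissible
import Summits.RiemannHypothesis.RiemannHypothesis.Theorems.WeilCombCombShapePositivityStubCauchyKernelRayBound
import Summits.RiemannHypothesis.RiemannHypothesis.Theorems.WeilCombCombShapePositivityStubCauchyKernelHolo
import Summits.RiemannHypothesis.RiemannHypothesis.Theorems.WeilCombCombShapePositivityStubDilationSeries
import Literature.NumberTheory.LFunctions.WeilCriterionConverse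
import Literature.NumberTheory.LFunctions.WeilExplicitFormulaProofs
import Literature.NumberTheory.LFunctions.WeilExplicitProofs
import Literature.NumberTheory.LFunctions.WeilMellinBounds
import Literature.NumberTheory.LFunctions.WeilMellinInversion
import Literature.NumberTheory.LFunctions.WeilDilationVirial
import Literature.NumberTheory.LFunctions.WeilZeroSum
import Literature.NumberTheory.LFunctions.LandauOscillation
import Mathlib

/-!
# Dilation detection II — holomorphy of the zero sum of kernels off the off-line segments

stub-plan `Cruxes/CombShapePositivity/STUB-PLAN-stub_fejer.md`, tier ★T2 DILATION DETECTION
(crux `WeilComb.CombShapePositivity`, item stmt-RiemannHypothesis-11229, route route-RiemannHypothesis-WeilComb,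
line `Sketch`; sprove seat). The five files `…StubDilationSeries` → `…KernelSum` → `…Landau` → `…Geometry` →
`…Detection` prove `stub_dilationDetection : (∀ ε ≥ 1, 0 ≤ Re W(φ_ε ⋆ φ̃_ε)) → RiemannHypothesis`
(a theorem ABOUT the RH-equivalent stub `stub_fejer` — its `S = ∅` face is already RH-complete — not a step
of `CombShapePositivity_of`).

This file: for a set `P ⊆ ℂ`, `G_P(s) = Σ_{ρ ∈ P} m(ρ) K(ρ − ½, s)` is complex differentiable at every
point of `U_P = {Re s > 0} ∖ ⋃_{ρ ∈ P} (ρ − ½)·[−2, 2]` (`GK_local`, registered as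
`zeroKernelSum_differentiableAt`): near `s₀` all but finitely many zeros are "favourable"
(`|Re w|·|Im s| < |Im w|·Re s`), where `cauchyKernel_rayBound` bounds the kernel by `12 C² m(ρ)/(1+γ²)²`
— locally uniform convergence — and the finitely many others are holomorphic off their own segments
(`cauchyKernel_differentiableOn`). Also the measurable function `g(x) = Re Q(φ_{log x})·1_{x>e}` of
Landau's lemma and `mellinIoi_gL`: `∫_1^∞ g x^{−(s+1)} dx = ∫_1^∞ Q(φ_ε) e^{−sε} dε`.
-/

noncomputable section

-- the sub-problem path RiemannHypothesis/RiemannHypothesis duplicates a namespace (D-0017)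
set_option linter.dupNamespace false

open scoped BigOperators ComplexConjugate Real Topology
open Complex MeasureTheory Set Filter

namespace Summit.RiemannHypothesis.RiemannHypothesis.Theorems.WeilCombBohrFejer

open Literature.NumberTheory.LFunctions
open Literature.NumberTheory.LFunctions.WeilConverse

/-! ## Notation (local, purely syntactic abbreviations of sub-terms of the registered stubs) -/

/-- the route bump `φ_ε(t) = ε⁻¹ φ₀(t/ε)` (verbatim sub-term of the registered stubs). -/
local notation "φb(" ε ")" =>
  (fun t : ℝ => ((ε : ℝ) : ℂ)⁻¹ * ((expNegInvGlue (1 - (t / ε) ^ 2) : ℝ) : ℂ))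

/-- the fixed bump as a complex function `φ₀ℂ(u) = expNegInvGlue (1 - u²)`. -/
local notation "φ₀ℂ" => (fun u : ℝ => ((expNegInvGlue (1 - u ^ 2) : ℝ) : ℂ))

/-- its entire transform `Φ₀(z) = ∫ φ₀(u) e^{zu} du`. -/
local notation "Φ₀(" z ")" =>
  (∫ u : ℝ, ((expNegInvGlue (1 - u ^ 2) : ℝ) : ℂ) * Complex.exp (z * u))

/-- the autocorrelation `ψ₀ = φ₀ ⋆ φ₀`. -/
local notation "ψ₀(" t ")" =>
  (∫ u : ℝ, expNegInvGlue (1 - u ^ 2) * expNegInvGlue (1 - (t - u) ^ 2))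

/-- the Cauchy–Laplace kernel of `ψ₀`: `K(w, s) = ∫_{-2}^{2} ψ₀(t) e^{wt − s}/(s − wt) dt`. -/
local notation "Kψ(" w ", " s ")" =>
  (∫ t in (-2 : ℝ)..2, (((∫ u : ℝ, expNegInvGlue (1 - u ^ 2) * expNegInvGlue (1 - (t - u) ^ 2)) : ℝ) : ℂ) *
    Complex.exp (w * t - s) / (s - w * t))

/-- the set of non-trivial zeros (subtype). -/
local notation "𝒵" => ZetaZeros.riemannZetaNontrivialZeros

/-- `g(x) = Re Q(φ_{log x})` for `x > e`, `0` otherwise — the non-negative function of Landau's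
lemma, in the multiplicative variable `x = e^ε`. Written with `max 1 (log x)` so that measurability
is immediate. -/
local notation "gL" =>
  (Set.indicator (Set.Ioi (Real.exp 1)) (fun x : ℝ => Complex.re (weilQuadratic φb(max 1 (Real.log x)))))

/-- the kernel attached to a complex number `ρ'` (weighted by the multiplicity) restricted to a
set `P` of zeros. -/
local notation "KP(" P ", " ρ' ", " s ")" =>
  (Set.indicator P (fun ρ'' : ℂ => (riemannZetaZeroOrder ρ'' : ℂ) * Kψ(ρ'' - 1 / 2, s)) ρ')

/-- the zero sum of kernels over the zeros in `P`: `G_P(s) = Σ_{ρ ∈ P} m(ρ) K(ρ − ½, s)`. -/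
local notation "GK(" P ", " s ")" => (∑' ρ : 𝒵, KP(P, (ρ : ℂ), s))

set_option quotPrecheck false in
/-- the natural domain of `G_P`: the right half-plane minus the segments `(ρ − ½)·[−2, 2]` of the
zeros `ρ ∈ P` (segments of on-line zeros lie on the imaginary axis and are excluded for free). -/
local notation "UP(" P ")" =>
  (setOf fun s : ℂ => 0 < Complex.re s ∧ ∀ ρ' : ℂ, ρ' ∈ P → ρ' ∈ ZetaZeros.riemannZetaNontrivialZeros →
    ∀ t : ℝ, t ∈ Set.Icc (-2 : ℝ) 2 → s ≠ (ρ' - 1 / 2) * t)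

/-- The transform of `ψ₀` decays like `(1 + (Im z)²)^{-2}`: `‖∫_{-2}^{2} ψ₀ e^{zt}‖ ≤ C² e^{2|Re z|}/(1+(Im z)²)²`

/-- `gL` is measurable. [folklore] -/
theorem measurable_gL : Measurable gL := by
  have hm : Measurable fun x : ℝ => weilQuadratic φb(max 1 (Real.log x)) := by
    have h1 : Continuous fun y : ℝ => max 1 y := continuous_const.max continuous_id
    have h2 : ∀ y : ℝ, max 1 y ∈ Ici (1 : ℝ) := fun y => Set.mem_Ici.2 (le_max_left _ _)
    have h3 : Continuous fun y : ℝ => weilQuadratic φb(max 1 y) :=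
      continuousOn_weilQuadratic_bump.comp_continuous h1 h2
    exact h3.measurable.comp Real.measurable_log
  exact (Complex.measurable_re.comp hm).indicator measurableSet_Ioi

/-- For `x > e`, `max 1 (log x) = log x`. [folklore] -/
theorem max_one_log_of_exp_lt {x : ℝ} (hx : Real.exp 1 < x) : max 1 (Real.log x) = Real.log x :=
  max_eq_right ((Real.lt_log_iff_exp_lt (lt_trans (Real.exp_pos 1) hx)).2 hx).le

/-- **The transform of Landau's lemma is the Laplace transform in the dilation variable**:
`∫_1^∞ g(x) x^{−(s+1)} dx = ∫_1^∞ Q(φ_ε) e^{−sε} dε` (substitute `x = e^ε`; `Q` is real).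
[folklore] -/
theorem mellinIoi_gL (s : ℂ) :
    Landau.mellinIoi gL s = ∫ ε in Ioi (1 : ℝ), weilQuadratic φb(ε) * Complex.exp (-(s * ε)) := by
  unfold Landau.mellinIoi
  -- restrict to `(e, ∞)`, where `g` lives
  have hsub : Ioi (Real.exp 1) ⊆ Ioi (1 : ℝ) := Ioi_subset_Ioi (Real.one_lt_exp_iff.2 one_pos).le
  rw [setIntegral_eq_of_subset_of_forall_sdiff_eq_zero measurableSet_Ioi hsub (fun x hx => by
    have hx' : x ∉ Ioi (Real.exp 1) := hx.2
    simp [Set.indicator_of_notMem hx'])]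
  -- substitute `x = e^ε`
  rw [setIntegral_congr_set (show Ioi (Real.exp 1) =ᵐ[volume] Real.exp '' Ioi 1 by
      rw [Real.image_exp_Ioi]),
    integral_image_eq_integral_abs_deriv_smul measurableSet_Ioi
      (fun x _ => (Real.hasDerivAt_exp x).hasDerivWithinAt) Real.exp_injective.injOn]
  refine setIntegral_congr_fun measurableSet_Ioi fun ε hε => ?_
  have hε : (1 : ℝ) < ε := hε
  have hx : Real.exp 1 < Real.exp ε := Real.exp_lt_exp.2 hε
  simp only [Set.indicator_of_mem (show Real.exp ε ∈ Ioi (Real.exp 1) from hx), Real.log_exp,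
    max_eq_right hε.le, abs_of_pos (Real.exp_pos ε), Complex.real_smul]
  rw [← weilQuadratic_bump_eq_re ε]
  have hpow : ((Real.exp ε : ℝ) : ℂ) ^ (-(s + 1)) = Complex.exp (-(s + 1) * ε) := by
    rw [Complex.ofReal_exp, Complex.cpow_def_of_ne_zero (Complex.exp_ne_zero _),
      Complex.log_exp (by simp [Real.pi_pos]) (by simp [Real.pi_pos.le]), mul_comm]
  rw [hpow, Complex.ofReal_exp]
  have : Complex.exp (ε : ℂ) * Complex.exp (-(s + 1) * ε) = Complex.exp (-(s * ε)) := by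
    rw [← Complex.exp_add]; ring_nf
  calc Complex.exp (ε : ℂ) * (weilQuadratic φb(ε) * Complex.exp (-(s + 1) * ε))
      = weilQuadratic φb(ε) * (Complex.exp (ε : ℂ) * Complex.exp (-(s + 1) * ε)) := by ring
    _ = _ := by rw [this]

/-! ## Holomorphy of the zero sum of kernels off the off-line segments -/

(it is `Φ₀(z)²`). [folklore] -/
theorem norm_transform_bumpAutocorr_le {C : ℝ} (hC0 : 0 ≤ C)
    (hC : ∀ z : ℂ, ‖Φ₀(z)‖ ≤ C * Real.exp |z.re| / (1 + ‖z‖ ^ 2)) (z : ℂ) :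
    ‖∫ t in (-2 : ℝ)..2, ((ψ₀(t) : ℝ) : ℂ) * Complex.exp (z * t)‖ ≤
      C ^ 2 * Real.exp (2 * |z.re|) / (1 + z.im ^ 2) ^ 2 := by
  rw [← bumpTransform_sq_eq, norm_pow]
  have h0 : 0 ≤ ‖Φ₀(z)‖ := norm_nonneg _
  have him : z.im ^ 2 ≤ ‖z‖ ^ 2 := by
    have := abs_im_le_norm z
    nlinarith [abs_nonneg z.im, sq_abs z.im, norm_nonneg z]
  have h1 : ‖Φ₀(z)‖ ≤ C * Real.exp |z.re| / (1 + z.im ^ 2) := by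
    refine (hC z).trans ?_
    exact div_le_div_of_nonneg_left (by positivity) (by positivity) (by linarith)
  calc ‖Φ₀(z)‖ ^ 2 ≤ (C * Real.exp |z.re| / (1 + z.im ^ 2)) ^ 2 := pow_le_pow_left₀ h0 h1 2
    _ = C ^ 2 * Real.exp (2 * |z.re|) / (1 + z.im ^ 2) ^ 2 := by
        rw [div_pow, mul_pow, ← Real.exp_nat_mul]
        norm_num

/-- Favourable zeros: if `s` is within `σ₀/2` of `s₀ = σ₀ + iτ₀` (`σ₀ > 0`) and `|γ| > |τ₀|/σ₀ + ½`,
`|a| ≤ ½`, then `|a|·|Im s| < |γ|·Re s`. [folklore] -/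
theorem favourable_of_mem_closedBall {s₀ s : ℂ} (hσ₀ : 0 < s₀.re)
    (hs : s ∈ Metric.closedBall s₀ (s₀.re / 2)) {a γ : ℝ} (ha : |a| ≤ 1 / 2)
    (hγ : |s₀.im| / s₀.re + 1 / 2 < |γ|) : |a| * |s.im| < |γ| * s.re := by
  rw [Metric.mem_closedBall, dist_eq_norm] at hs
  have h1 : |(s - s₀).re| ≤ s₀.re / 2 := (abs_re_le_norm _).trans hs
  have h2 : |(s - s₀).im| ≤ s₀.re / 2 := (abs_im_le_norm _).trans hs
  simp only [sub_re, sub_im] at h1 h2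
  have hre : s₀.re / 2 ≤ s.re := by linarith [(abs_le.1 h1).1]
  have him : |s.im| ≤ |s₀.im| + s₀.re / 2 := by
    calc |s.im| = |(s.im - s₀.im) + s₀.im| := by ring_nf
      _ ≤ |s.im - s₀.im| + |s₀.im| := abs_add_le _ _
      _ ≤ _ := by linarith
  have hγ' : |s₀.im| + s₀.re / 2 < |γ| * s₀.re := by
    have h := mul_lt_mul_of_pos_right hγ hσ₀
    have e : (|s₀.im| / s₀.re + 1 / 2) * s₀.re = |s₀.im| + s₀.re / 2 := by
      field_simp
    linarith
  calc |a| * |s.im| ≤ 1 / 2 * (|s₀.im| + s₀.re / 2) :=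
        mul_le_mul ha him (abs_nonneg _) (by norm_num)
    _ < 1 / 2 * (|γ| * s₀.re) := by linarith
    _ = |γ| * (s₀.re / 2) := by ring
    _ ≤ |γ| * s.re := mul_le_mul_of_nonneg_left hre (abs_nonneg _)

/-- A favourable point is off the segment: `|a||Im s| < |γ| Re s` excludes `s = (a + iγ) t`. [folklore] -/
theorem ne_seg_of_favourable {s w : ℂ} (h : |w.re| * |s.im| < |w.im| * s.re) (t : ℝ) : s ≠ w * t := by
  rintro rfl
  simp only [Complex.mul_re, Complex.mul_im, Complex.ofReal_re, Complex.ofReal_im, mul_zero,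
    sub_zero, zero_add] at h
  rw [abs_mul] at h
  have : |w.im| * (w.re * t) ≤ |w.im| * (|w.re| * |t|) := by
    refine mul_le_mul_of_nonneg_left ?_ (abs_nonneg _)
    rw [← abs_mul]; exact le_abs_self _
  nlinarith [abs_nonneg w.re, abs_nonneg w.im, abs_nonneg t]

/-- The zeros with `|Im ρ| ≤ T` form a finite subset of the subtype of non-trivial zeros. [folklore] -/
theorem finite_zeros_abs_im_le (T : ℝ) : {ρ : 𝒵 | |(ρ : ℂ).im| ≤ T}.Finite := by
  have h := (weilZeroIndex_finite T).preimage (Subtype.val_injective.injOn (s := (Set.univ : Set 𝒵)) |>.mono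
    (Set.subset_univ _))
  refine h.subset fun ρ hρ => ?_
  show (ρ : ℂ) ∈ weilZeroIndex T
  rw [weilZeroIndex_eq_inter]
  exact ⟨ρ.2, hρ⟩

/-- Bookkeeping on a zero: `|Re(ρ − ½)| ≤ ½` and `Im(ρ − ½) = Im ρ`. [folklore] -/
theorem abs_re_shift_le {ρ : ℂ} (hρ : ρ ∈ 𝒵) : |(ρ - 1 / 2).re| ≤ 1 / 2 := abs_re_sub_half_le hρ

/-- `Im(ρ − ½) = Im ρ`. [folklore] -/
theorem im_shift (ρ : ℂ) : (ρ - 1 / 2).im = ρ.im := by simp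

/-- From `|γ| ≥ 1`: `1/|γ|⁴ ≤ 4/(1 + γ²)²`. [folklore] -/
theorem inv_pow_four_le {γ : ℝ} (hγ : 1 ≤ |γ|) : 1 / |γ| ^ 4 ≤ 4 / (1 + γ ^ 2) ^ 2 := by
  have h1 : 1 ≤ γ ^ 2 := by nlinarith [sq_abs γ, abs_nonneg γ]
  have h2 : (1 + γ ^ 2) ^ 2 ≤ 4 * |γ| ^ 4 := by
    have : |γ| ^ 4 = (γ ^ 2) ^ 2 := by rw [show (4 : ℕ) = 2 * 2 from rfl, pow_mul, sq_abs]
    rw [this]; nlinarith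
  rw [div_le_div_iff₀ (by positivity) (by positivity)]
  linarith

/-- **Holomorphy of the zero sum of kernels.** For any set `P ⊆ ℂ`, the function
`G_P(s) = Σ_{ρ ∈ P} m(ρ) K(ρ − ½, s)` (sum over the non-trivial zeros lying in `P`) is complex
differentiable at every point of `U_P` (right half-plane minus the segments of the zeros in `P`):
near `s₀` all but finitely many zeros are favourable, their kernels are bounded by `12 C² m(ρ)/(1+γ²)²`
(`cauchyKernel_rayBound`) and holomorphic there, so the tail converges locally uniformly
(`differentiableOn_tsum_of_summable_norm`); the finitely many remaining kernels are holomorphic off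
their own segments (`cauchyKernel_differentiableOn`). [folklore] -/
theorem GK_local (P : Set ℂ) {s₀ : ℂ} (hs₀ : s₀ ∈ UP(P)) :
    ∃ U : Set ℂ, IsOpen U ∧ s₀ ∈ U ∧ DifferentiableOn ℂ (fun s : ℂ => GK(P, s)) U ∧
      ∀ s ∈ U, Summable fun ρ : 𝒵 => KP(P, (ρ : ℂ), s) := by
  obtain ⟨C, hC0, hC⟩ := bumpTransform_decay'
  have hσ₀ : 0 < s₀.re := hs₀.1
  have hseg := hs₀.2
  have hcont : Continuous fun t : ℝ => ((ψ₀(t) : ℝ) : ℂ) :=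
    Complex.continuous_ofReal.comp continuous_bumpAutocorr
  have hdecψ := norm_transform_bumpAutocorr_le hC0 hC
  -- threshold separating the finitely many "bad" zeros
  set T : ℝ := max 1 (|s₀.im| / s₀.re + 1) with hT
  have hT1 : 1 ≤ T := le_max_left _ _
  set Bad : Set 𝒵 := {ρ : 𝒵 | |(ρ : ℂ).im| ≤ T} with hBad
  have hBadfin : Bad.Finite := finite_zeros_abs_im_le T
  -- an open set around `s₀` avoiding the segments of the bad zeros in `P`
  set D : Set ℂ := ⋂ ρ ∈ {ρ : 𝒵 | ρ ∈ Bad ∧ (ρ : ℂ) ∈ P},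
    {s : ℂ | ∀ t : ℝ, t ∈ Set.Icc (-2 : ℝ) 2 → s ≠ ((ρ : ℂ) - 1 / 2) * t} with hD
  have hDo : IsOpen D :=
    (hBadfin.subset (fun ρ hρ => hρ.1)).isOpen_biInter fun ρ _ => isOpen_cauchyKernelDomain _
  have hs₀D : s₀ ∈ D := by
    simp only [hD, Set.mem_iInter, Set.mem_setOf_eq]
    intro ρ hρ t ht
    exact hseg (ρ : ℂ) hρ.2 ρ.2 t ht
  obtain ⟨ε, hε, hball⟩ := Metric.isOpen_iff.1 hDo s₀ hs₀D
  set r₁ : ℝ := min (ε / 2) (s₀.re / 2) with hr₁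
  have hr₁0 : 0 < r₁ := lt_min (by linarith) (by linarith)
  set U : Set ℂ := Metric.ball s₀ r₁ with hU
  have hUo : IsOpen U := Metric.isOpen_ball
  have hs₀U : s₀ ∈ U := Metric.mem_ball_self hr₁0
  have hUD : U ⊆ D := (Metric.ball_subset_ball (by
    have : r₁ ≤ ε / 2 := min_le_left _ _; linarith)).trans hball
  have hUcb : U ⊆ Metric.closedBall s₀ (s₀.re / 2) :=
    (Metric.ball_subset_ball (min_le_right _ _)).trans Metric.ball_subset_closedBall
  have hUre : ∀ s ∈ U, 0 ≤ s.re := by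
    intro s hs
    have h := hUcb hs
    rw [Metric.mem_closedBall, dist_eq_norm] at h
    have := (abs_re_le_norm (s - s₀)).trans h
    rw [sub_re, abs_le] at this
    linarith [this.1]
  -- the terms and their holomorphy on `U`
  set F : 𝒵 → ℂ → ℂ := fun ρ s => KP(P, (ρ : ℂ), s) with hF
  have hgoodfav : ∀ ρ : 𝒵, ρ ∉ Bad → ∀ s ∈ U,
      |((ρ : ℂ) - 1 / 2).re| * |s.im| < |((ρ : ℂ) - 1 / 2).im| * s.re := by
    intro ρ hρ s hs
    have hγ : T < |(ρ : ℂ).im| := lt_of_not_ge hρ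
    rw [im_shift]
    refine favourable_of_mem_closedBall hσ₀ (hUcb hs) (abs_re_shift_le ρ.2) ?_
    have : |s₀.im| / s₀.re + 1 ≤ T := le_max_right _ _
    linarith
  have hFdiff : ∀ ρ : 𝒵, DifferentiableOn ℂ (F ρ) U := by
    intro ρ
    by_cases hP : (ρ : ℂ) ∈ P
    · have e : F ρ = fun s => (riemannZetaZeroOrder (ρ : ℂ) : ℂ) * Kψ((ρ : ℂ) - 1 / 2, s) := by
        funext s; simp only [hF, Set.indicator_of_mem hP]
      rw [e]
      refine DifferentiableOn.const_mul ((cauchyKernel_differentiableOn _ hcont _).mono ?_) _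
      intro s hs t ht
      by_cases hbad : ρ ∈ Bad
      · have hsD := hUD hs
        simp only [hD, Set.mem_iInter, Set.mem_setOf_eq] at hsD
        exact hsD ρ ⟨hbad, hP⟩ t ht
      · exact ne_seg_of_favourable (hgoodfav ρ hbad s hs) t
    · have e : F ρ = fun _ => 0 := by
        funext s; simp only [hF, Set.indicator_of_notMem hP]
      rw [e]
      exact differentiableOn_const 0
  -- bound for the good terms
  have hFle : ∀ ρ : 𝒵, ρ ∉ Bad → ∀ s ∈ U, ‖F ρ s‖ ≤ 12 * C ^ 2 * weilZeroWeight (ρ : ℂ) := by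
    intro ρ hρ s hs
    have hγ : T < |(ρ : ℂ).im| := lt_of_not_ge hρ
    have hγ1 : 1 ≤ |(ρ : ℂ).im| := hT1.trans hγ.le
    have hm : (0 : ℝ) ≤ riemannZetaZeroOrder (ρ : ℂ) := by
      exact_mod_cast riemannZetaZeroOrder_nonneg (ZetaZeros.riemannZetaNontrivialZeros.ne_one ρ.2)
    have hw0 : 0 ≤ weilZeroWeight (ρ : ℂ) := weilZeroWeight_nonneg ρ.2
    by_cases hP : (ρ : ℂ) ∈ P
    · simp only [hF, Set.indicator_of_mem hP, norm_mul, Complex.norm_intCast, abs_of_nonneg hm]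
      have hK := cauchyKernel_rayBound _ (C ^ 2) hcont hdecψ ((ρ : ℂ) - 1 / 2) s
        (abs_re_shift_le ρ.2) (by rw [im_shift]; exact hγ1) (hUre s hs) (hgoodfav ρ hρ s hs)
      rw [im_shift] at hK
      have h4 := inv_pow_four_le hγ1
      calc (riemannZetaZeroOrder (ρ : ℂ) : ℝ) * ‖Kψ((ρ : ℂ) - 1 / 2, s)‖
          ≤ (riemannZetaZeroOrder (ρ : ℂ) : ℝ) * (3 * C ^ 2 / |(ρ : ℂ).im| ^ 4) :=
            mul_le_mul_of_nonneg_left hK hm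
        _ = 3 * C ^ 2 * (riemannZetaZeroOrder (ρ : ℂ) : ℝ) * (1 / |(ρ : ℂ).im| ^ 4) := by ring
        _ ≤ 3 * C ^ 2 * (riemannZetaZeroOrder (ρ : ℂ) : ℝ) * (4 / (1 + (ρ : ℂ).im ^ 2) ^ 2) :=
            mul_le_mul_of_nonneg_left h4 (by positivity)
        _ = 12 * C ^ 2 * weilZeroWeight (ρ : ℂ) := by rw [weilZeroWeight]; ring
    · simp only [hF, Set.indicator_of_notMem hP, norm_zero]
      positivity
  -- split off the bad zeros and sum the tail locally uniformly
  set B : Finset 𝒵 := hBadfin.toFinset with hB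
  have hmemB : ∀ ρ : 𝒵, ρ ∈ B ↔ ρ ∈ Bad := fun ρ => Set.Finite.mem_toFinset _
  have htail_sum : Summable fun ρ : {ρ : 𝒵 // ρ ∉ B} => 12 * C ^ 2 * weilZeroWeight ((ρ : 𝒵) : ℂ) :=
    (weilZeroSummable.mul_left (12 * C ^ 2)).subtype _
  have htail_diff : DifferentiableOn ℂ (fun s => ∑' ρ : {ρ : 𝒵 // ρ ∉ B}, F (ρ : 𝒵) s) U := by
    refine differentiableOn_tsum_of_summable_norm htail_sum (fun ρ => hFdiff ρ) hUo ?_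
    intro ρ s hs
    exact hFle ρ (fun h => ρ.2 ((hmemB ρ).2 h)) s hs
  have hsumm : ∀ s ∈ U, Summable fun ρ : 𝒵 => F ρ s := by
    intro s hs
    refine (Finset.summable_compl_iff B).1 ?_
    refine Summable.of_norm_bounded htail_sum fun ρ => ?_
    exact hFle ρ (fun h => ρ.2 ((hmemB ρ).2 h)) s hs
  have hsplit : ∀ s ∈ U, GK(P, s) = (∑ ρ ∈ B, F ρ s) + ∑' ρ : {ρ : 𝒵 // ρ ∉ B}, F (ρ : 𝒵) s := by
    intro s hs
    exact ((hsumm s hs).sum_add_tsum_compl (s := B)).symm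
  have hGdiff : DifferentiableOn ℂ (fun s : ℂ => GK(P, s)) U := by
    refine DifferentiableOn.congr ?_ hsplit
    exact (DifferentiableOn.fun_sum fun ρ _ => hFdiff ρ).add htail_diff
  exact ⟨U, hUo, hs₀U, hGdiff, hsumm⟩

/-- `G_P` is complex differentiable at every point of `U_P`. [folklore] -/
theorem differentiableAt_GK (P : Set ℂ) {s₀ : ℂ} (hs₀ : s₀ ∈ UP(P)) :
    DifferentiableAt ℂ (fun s : ℂ => GK(P, s)) s₀ := by
  obtain ⟨U, hUo, hs₀U, hdiff, -⟩ := GK_local P hs₀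
  exact hdiff.differentiableAt (hUo.mem_nhds hs₀U)

/-- The series defining `G_P(s)` converges at every point of `U_P`. [folklore] -/
theorem summable_KP (P : Set ℂ) {s₀ : ℂ} (hs₀ : s₀ ∈ UP(P)) :
    Summable fun ρ : 𝒵 => KP(P, (ρ : ℂ), s₀) := by
  obtain ⟨U, -, hs₀U, -, hsum⟩ := GK_local P hs₀
  exact hsum s₀ hs₀U

/-- `G_P` is holomorphic on every subset of `U_P`. [folklore] -/
theorem differentiableOn_GK (P : Set ℂ) {V : Set ℂ} (hV : V ⊆ UP(P)) :
    DifferentiableOn ℂ (fun s : ℂ => GK(P, s)) V :=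
  fun _ hs => (differentiableAt_GK P (hV hs)).differentiableWithinAt

/-- **Registered form `zeroKernelSum_differentiableAt`** (crux stmt-RiemannHypothesis-11229, T2 component):
`G_P` is complex differentiable at every point of `U_P`. [folklore] -/
theorem zeroKernelSum_differentiableAt :
    ∀ (P : Set ℂ) (s₀ : ℂ), s₀ ∈ (setOf fun s : ℂ => 0 < Complex.re s ∧ ∀ ρ' : ℂ, ρ' ∈ P → ρ' ∈
    ZetaZeros.riemannZetaNontrivialZeros → ∀ t : ℝ, t ∈ Set.Icc (-2 : ℝ) 2 → s ≠ (ρ' - 1 / 2) * t) →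
    DifferentiableAt ℂ (fun s : ℂ => (∑' ρ : ZetaZeros.riemannZetaNontrivialZeros, (Set.indicator P
    (fun ρ'' : ℂ => (riemannZetaZeroOrder ρ'' : ℂ) * (∫ t in (-2 : ℝ)..2, (((∫ u : ℝ, expNegInvGlue
    (1 - u ^ 2) * expNegInvGlue (1 - (t - u) ^ 2)) : ℝ) : ℂ) * Complex.exp ((ρ'' - 1 / 2) * t - s) /
    (s - (ρ'' - 1 / 2) * t))) (ρ : ℂ)))) s₀ :=
  fun P _ hs₀ => differentiableAt_GK P hs₀

end Summit.RiemannHypothesis.RiemannHypothesis.Theorems.WeilCombBohrFejer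

end
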